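import Summits.ResolutionOfSingularities.ResolutionOfSingularities.Theorems.FrobeniusLadderFRationalResolutionCompletionOfFlatUnramified
import Mathlib.RingTheory.RingHom.Flat
import Mathlib.RingTheory.Localization.AtPrime.Basic
import HarnessLib

/-!
# Crux `FrobeniusLadder.FRationalResolution` (stmt-ResolutionOfSingularities-15317), line `redirect`,
# stub `stub_diagonalizableQuotientResolution` — `(B'_{𝔔'})^ ≅ (C'_𝔚)^` AT A FLAT, UNRAMIFIED, RESIDUE-TRIVIAL PRIME
# (item (δ) of MEMO-15317-leafhand2-g16 §3 in the notation of the Galois route, `…GaloisUpstairsPieceCover.exists_piece_cover`)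

`…CompletionOfFlatUnramified.adicCompletionMap_bijective_of_flat` (p838948) is the local-ring statement. The Galois route
carries its residue-trivial chart point in RING-LEVEL form: a flat `B'`-algebra `C'` (`= B' ⊗_B C`, base change of the étale
quotient chart), a maximal `𝔚 ⊆ C'` over the maximal `𝔔' ⊆ B'`, unramified (`𝔔' C'_𝔚 = 𝔚 C'_𝔚`,
`…GaloisUpstairsPiece.map_eq_maximalIdeal_of_formallyUnramified`) with trivial residue extension
(`∀ x : C', ∃ b', x - b' ∈ 𝔚`, the hypothesis `hres` of `exists_piece_cover`). This file translates:

* `map_maximalIdeal_localRingHom_eq` — `𝔪_{B'_{𝔔'}} C'_𝔚 = 𝔪_{C'_𝔚}` from `𝔔' C'_𝔚 = 𝔚 C'_𝔚`;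
* `forall_exists_sub_localRingHom_mem` — the residue condition localizes: every `c ∈ C'_𝔚` is `≡ ℓ(b) mod 𝔪` for some
  `b ∈ B'_{𝔔'}` (`ℓ = Localization.localRingHom`; `𝔚` maximal, Mathlib `IsLocalization.AtPrime.equivQuotMaximalIdeal`);
* ★ `adicCompletionMap_localRingHom_bijective` — **`(B'_{𝔔'})^ → (C'_𝔚)^` is bijective** (flatness localizes, Mathlib
  `RingHom.Flat.localRingHom`), and `exists_ringEquiv_adicCompletion_localRingHom` — the isomorphism `Ê ≅ (C'_𝔚)^` over `ℓ`.

So the complete local ring `Ê = ((B ⊗_K K')_{𝔔'})^` of the Galois route IS the completion of the chart ring at the residue-trivial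
point, with no analytic-irreducibility or dimension hypothesis. Honest label: plumbing toward ONE leaf stub (no stub, crux or summit
closed). No definitions, no named facts, no sorry. [cite: Matsumura1987, Thm. 8.4; Thm. 22.4 (i)] [cite: StacksProject, Tag 0C4G; Tag 02G8]
-/

noncomputable section

-- single-problem summit: the doubled namespace component is forced
set_option linter.dupNamespace false

open IsLocalRing AdicCompletion AlgebraicGeometry
open Literature.AlgebraicGeometry.Resolution
open Summit.ResolutionOfSingularities.ResolutionOfSingularities.Theorems.FRationalResolution

namespace Summit.ResolutionOfSingularities.ResolutionOfSingularities.Theorems.FRationalResolution.CompletionOfFlatUnramifiedAtPrime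

/-- `ℓ ∘ (B' → B'_{𝔔'}) = (C' → C'_𝔚) ∘ (B' → C')` for `ℓ = Localization.localRingHom 𝔔' 𝔚`. [folklore] -/
theorem localRingHom_comp_algebraMap {B' C' : Type} [CommRing B'] [CommRing C'] [Algebra B' C']
    (𝔔' : Ideal B') [𝔔'.IsPrime] (𝔚 : Ideal C') [𝔚.IsPrime] (h𝔚B : 𝔚.comap (algebraMap B' C') = 𝔔') :
    (Localization.localRingHom 𝔔' 𝔚 (algebraMap B' C') h𝔚B.symm).comp (algebraMap B' (Localization.AtPrime 𝔔')) =
      (algebraMap C' (Localization.AtPrime 𝔚)).comp (algebraMap B' C') := by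
  ext x
  simp only [RingHom.coe_comp, Function.comp_apply, Localization.localRingHom_to_map]

/-- **`𝔪_{B'_{𝔔'}} C'_𝔚 = 𝔪_{C'_𝔚}`** from `𝔔' C'_𝔚 = 𝔚 C'_𝔚 = 𝔪_{C'_𝔚}`. [cite: StacksProject, Tag 02G8] -/
theorem map_maximalIdeal_localRingHom_eq {B' C' : Type} [CommRing B'] [CommRing C'] [Algebra B' C']
    (𝔔' : Ideal B') [𝔔'.IsPrime] (𝔚 : Ideal C') [𝔚.IsPrime] (h𝔚B : 𝔚.comap (algebraMap B' C') = 𝔔')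
    (hunr : 𝔔'.map (algebraMap B' (Localization.AtPrime 𝔚)) = maximalIdeal (Localization.AtPrime 𝔚)) :
    (maximalIdeal (Localization.AtPrime 𝔔')).map (Localization.localRingHom 𝔔' 𝔚 (algebraMap B' C') h𝔚B.symm) =
      maximalIdeal (Localization.AtPrime 𝔚) := by
  rw [← Localization.AtPrime.map_eq_maximalIdeal, Ideal.map_map, localRingHom_comp_algebraMap 𝔔' 𝔚 h𝔚B,
    ← IsScalarTower.algebraMap_eq, hunr]

/-- **The residue condition localizes**: if every `x ∈ C'` is `≡ b' mod 𝔚` for some `b' ∈ B'` (`𝔚` maximal), then every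
`c ∈ C'_𝔚` is `≡ ℓ(b) mod 𝔪_{C'_𝔚}` for some `b ∈ B'_{𝔔'}`. [folklore] -/
theorem forall_exists_sub_localRingHom_mem {B' C' : Type} [CommRing B'] [CommRing C'] [Algebra B' C']
    (𝔔' : Ideal B') [𝔔'.IsPrime] (𝔚 : Ideal C') [h𝔚 : 𝔚.IsMaximal] (h𝔚B : 𝔚.comap (algebraMap B' C') = 𝔔')
    (hres : ∀ x : C', ∃ b' : B', x - algebraMap B' C' b' ∈ 𝔚) :
    ∀ c : Localization.AtPrime 𝔚, ∃ b : Localization.AtPrime 𝔔',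
      c - Localization.localRingHom 𝔔' 𝔚 (algebraMap B' C') h𝔚B.symm b ∈ maximalIdeal (Localization.AtPrime 𝔚) := by
  intro c
  -- `c ≡ x mod 𝔪` for some `x ∈ C'` (the residue field of `C'_𝔚` is `C'/𝔚`)
  obtain ⟨y, hy⟩ := Ideal.Quotient.mk_surjective
    ((IsLocalization.AtPrime.equivQuotMaximalIdeal 𝔚 (Localization.AtPrime 𝔚)).symm (Ideal.Quotient.mk _ c))
  have hx : Ideal.Quotient.mk (maximalIdeal (Localization.AtPrime 𝔚)) (algebraMap C' (Localization.AtPrime 𝔚) y) =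
      Ideal.Quotient.mk _ c := by
    rw [← IsLocalization.AtPrime.equivQuotMaximalIdeal_apply_mk 𝔚 (Localization.AtPrime 𝔚), hy,
      RingEquiv.apply_symm_apply]
  have h1 : c - algebraMap C' (Localization.AtPrime 𝔚) y ∈ maximalIdeal (Localization.AtPrime 𝔚) := by
    rw [← Ideal.Quotient.eq, hx]
  -- `y ≡ b' mod 𝔚`
  obtain ⟨b', hb'⟩ := hres y
  refine ⟨algebraMap B' (Localization.AtPrime 𝔔') b', ?_⟩
  have h2 : algebraMap C' (Localization.AtPrime 𝔚) y -
      Localization.localRingHom 𝔔' 𝔚 (algebraMap B' C') h𝔚B.symm (algebraMap B' (Localization.AtPrime 𝔔') b') ∈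
      maximalIdeal (Localization.AtPrime 𝔚) := by
    rw [Localization.localRingHom_to_map, ← map_sub, ← Localization.AtPrime.map_eq_maximalIdeal]
    exact Ideal.mem_map_of_mem _ hb'
  have h3 := Ideal.add_mem _ h1 h2
  rwa [sub_add_sub_cancel] at h3

/-- ★ **`(B'_{𝔔'})^ → (C'_𝔚)^` is bijective** for `C'` flat over `B'`, `𝔚` maximal over `𝔔'`, unramified (`𝔔' C'_𝔚 = 𝔪_{C'_𝔚}`) and
residue-trivial (`∀ x, ∃ b', x - b' ∈ 𝔚`). [cite: Matsumura1987, Thm. 8.4; Thm. 22.4 (i)] [cite: StacksProject, Tag 0C4G] -/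
theorem adicCompletionMap_localRingHom_bijective {B' C' : Type} [CommRing B'] [CommRing C'] [Algebra B' C'] [Module.Flat B' C']
    (𝔔' : Ideal B') [𝔔'.IsPrime] (𝔚 : Ideal C') [h𝔚 : 𝔚.IsMaximal] (h𝔚B : 𝔚.comap (algebraMap B' C') = 𝔔')
    (hunr : 𝔔'.map (algebraMap B' (Localization.AtPrime 𝔚)) = maximalIdeal (Localization.AtPrime 𝔚))
    (hres : ∀ x : C', ∃ b' : B', x - algebraMap B' C' b' ∈ 𝔚) :
    Function.Bijective (adicCompletionMap (maximalIdeal (Localization.AtPrime 𝔔')) (maximalIdeal (Localization.AtPrime 𝔚))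
      (Localization.localRingHom 𝔔' 𝔚 (algebraMap B' C') h𝔚B.symm)
      (map_maximalIdeal_localRingHom_eq 𝔔' 𝔚 h𝔚B hunr).le) := by
  set ℓ := Localization.localRingHom 𝔔' 𝔚 (algebraMap B' C') h𝔚B.symm with hℓ
  have hflat : ℓ.Flat :=
    RingHom.Flat.localRingHom (f := algebraMap B' C') (RingHom.flat_algebraMap_iff.mpr inferInstance) 𝔚 𝔔' h𝔚B.symm
  letI : Algebra (Localization.AtPrime 𝔔') (Localization.AtPrime 𝔚) := ℓ.toAlgebra
  haveI : Module.Flat (Localization.AtPrime 𝔔') (Localization.AtPrime 𝔚) := hflat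
  haveI : IsLocalHom (algebraMap (Localization.AtPrime 𝔔') (Localization.AtPrime 𝔚)) :=
    Localization.isLocalHom_localRingHom 𝔔' 𝔚 (algebraMap B' C') h𝔚B.symm
  exact CompletionOfFlatUnramified.adicCompletionMap_bijective_of_flat (A := Localization.AtPrime 𝔔')
    (B := Localization.AtPrime 𝔚) (map_maximalIdeal_localRingHom_eq 𝔔' 𝔚 h𝔚B hunr)
    (forall_exists_sub_localRingHom_mem 𝔔' 𝔚 h𝔚B hres)

/-- The isomorphism `(B'_{𝔔'})^ ≃+* (C'_𝔚)^` over `ℓ = Localization.localRingHom 𝔔' 𝔚`, as an existence statement (no data is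
defined here). [cite: Matsumura1987, Thm. 8.4] -/
theorem exists_ringEquiv_adicCompletion_localRingHom {B' C' : Type} [CommRing B'] [CommRing C'] [Algebra B' C']
    [Module.Flat B' C'] (𝔔' : Ideal B') [𝔔'.IsPrime] (𝔚 : Ideal C') [h𝔚 : 𝔚.IsMaximal]
    (h𝔚B : 𝔚.comap (algebraMap B' C') = 𝔔')
    (hunr : 𝔔'.map (algebraMap B' (Localization.AtPrime 𝔚)) = maximalIdeal (Localization.AtPrime 𝔚))
    (hres : ∀ x : C', ∃ b' : B', x - algebraMap B' C' b' ∈ 𝔚) :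
    ∃ e : AdicCompletion (maximalIdeal (Localization.AtPrime 𝔔')) (Localization.AtPrime 𝔔') ≃+*
        AdicCompletion (maximalIdeal (Localization.AtPrime 𝔚)) (Localization.AtPrime 𝔚),
      ∀ b : Localization.AtPrime 𝔔',
        e (algebraMap (Localization.AtPrime 𝔔') _ b) =
          algebraMap (Localization.AtPrime 𝔚) _ (Localization.localRingHom 𝔔' 𝔚 (algebraMap B' C') h𝔚B.symm b) := by
  refine ⟨RingEquiv.ofBijective _ (adicCompletionMap_localRingHom_bijective 𝔔' 𝔚 h𝔚B hunr hres), fun b => ?_⟩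
  rw [RingEquiv.ofBijective_apply, AdicCompletion.algebraMap_apply, AdicCompletion.algebraMap_apply]
  exact adicCompletionMap_of _ _ _ _ b

/-- In particular, for an ideal `I ⊆ B'_{𝔔'}`: `Bl_{I Ê}(Spec Ê)` regular ⇒ `Bl_{I (C'_𝔚)^}(Spec (C'_𝔚)^)` regular, and — applying the
same statement to the inverse isomorphism — conversely; stated here in the direction the toric computation is fed INTO `Ê`:
**`Bl` regularity computed on the completed chart ring transfers to `Ê`** (`e⁻¹`). [folklore] -/
theorem isRegular_affineBlowup_adicCompletion_of_chart {B' C' : Type} [CommRing B'] [CommRing C'] [Algebra B' C']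
    [Module.Flat B' C'] (𝔔' : Ideal B') [𝔔'.IsPrime] (𝔚 : Ideal C') [h𝔚 : 𝔚.IsMaximal]
    (h𝔚B : 𝔚.comap (algebraMap B' C') = 𝔔')
    (hunr : 𝔔'.map (algebraMap B' (Localization.AtPrime 𝔚)) = maximalIdeal (Localization.AtPrime 𝔚))
    (hres : ∀ x : C', ∃ b' : B', x - algebraMap B' C' b' ∈ 𝔚)
    (I : Ideal (Localization.AtPrime 𝔔'))
    (hreg : Scheme.IsRegular (affineBlowup
      ((I.map (Localization.localRingHom 𝔔' 𝔚 (algebraMap B' C') h𝔚B.symm)).map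
        (algebraMap (Localization.AtPrime 𝔚) (AdicCompletion (maximalIdeal (Localization.AtPrime 𝔚)) (Localization.AtPrime 𝔚)))))) :
    Scheme.IsRegular (affineBlowup
      (I.map (algebraMap (Localization.AtPrime 𝔔')
        (AdicCompletion (maximalIdeal (Localization.AtPrime 𝔔')) (Localization.AtPrime 𝔔'))))) := by
  obtain ⟨e, he⟩ := exists_ringEquiv_adicCompletion_localRingHom 𝔔' 𝔚 h𝔚B hunr hres
  have h := BlowupOrbitCentre.isRegular_affineBlowup_map_of_ringEquiv e.symm _ hreg
  have hcomp : ((I.map (Localization.localRingHom 𝔔' 𝔚 (algebraMap B' C') h𝔚B.symm)).map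
      (algebraMap (Localization.AtPrime 𝔚) (AdicCompletion (maximalIdeal (Localization.AtPrime 𝔚)) (Localization.AtPrime 𝔚)))).map
      (e.symm : _ →+* _) =
      I.map (algebraMap (Localization.AtPrime 𝔔')
        (AdicCompletion (maximalIdeal (Localization.AtPrime 𝔔')) (Localization.AtPrime 𝔔'))) := by
    rw [Ideal.map_map, Ideal.map_map]
    congr 1
    exact RingHom.ext fun b => by
      simp only [RingHom.coe_comp, RingHom.coe_coe, Function.comp_apply]
      rw [RingEquiv.symm_apply_eq]
      exact (he b).symm
  rw [hcomp] at h
  exact h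

end Summit.ResolutionOfSingularities.ResolutionOfSingularities.Theorems.FRationalResolution.CompletionOfFlatUnramifiedAtPrime

end
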